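import Summits.BirchSwinnertonDyer.Rank1Residual.X2.DualRestrictionInvariants
import Literature.NumberTheory.EllipticCurves.IwasawaSelmerIsTorsionProofs
import HarnessLib

/-!
# Route `SignedLowerHalves`, crux L `SmallImageLowerHalfBothSigns` (stmt-BirchSwinnertonDyer-23599), line `rtt_w3` v13 — E2, LEAD: THE `λ`-ALGEBRA OF THE
# POITOU–TATE GLUE (BRIEF-E2 rev 2 §3, `Lines/rtt_w3-BRIEF-E2-g8.md`)

WHY: after v13 the registered research stub is the E2-tail (the lower half of the `±` main conjecture for the CM partner at the inert `p`, in `λ`-currency).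
Its cut of record (Kobayashi Thm 7.3 pattern) reads E2 off a four-term Poitou–Tate sequence `0 → 𝐇¹_Σ →ᶠ 𝐇¹_v/E^ε →ᵍ X →ʰ 𝐇²_Σ → 0`, the global input
`λ(𝐇²_Σ) ≥ λ(𝐇¹_Σ/Z)` (`Z` = the zeta line) and the analytic identification of `(𝐇¹_v/E^ε)/f(Z) ≅ Λ_𝒪/(Col loc z)`. This file is the ROAD-INDEPENDENT module algebra of
that reading, for arbitrary `Λ = ℤ_p⟦T⟧`-modules and the tree's `lambdaInvariant` (`dim_{ℚ_p}(ℚ_p ⊗_{ℤ_p} ·)`):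
(A) `lambdaInvariant_eq_add_of_fourTerm`: `H →ᶠ Q →ᵍ X →ʰ Y → 0` exact, `X` f.g. torsion ⇒ `λ X = λ Y + λ (Q ⧸ range f)`;
(B) `lambdaInvariant_quotient_map_eq_add`: `f` injective, `Z ≤ H`, `Q ⧸ f(Z)` f.g. torsion ⇒ `λ (Q ⧸ f(Z)) = λ (H ⧸ Z) + λ (Q ⧸ range f)`;
(C) `lambdaInvariant_quotient_map_le_of_fourTerm`: (A)+(B)+`λ (H ⧸ Z) ≤ λ Y` ⇒ `λ (Q ⧸ f(Z)) ≤ λ X` — the shape of E2's inequality.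
THEOREMS ONLY (kernel commutative algebra); nothing about `BirchSwinnertonDyer`, crux L or E2 itself is proved here. [cite: Kobayashi2003, Thm. 7.3] [cite: Washington1997, §13.2]
-/

set_option linter.dupNamespace false -- D-0017: single-problem summit, the namespace repeats the problem name by design

noncomputable section

open scoped Classical

universe u v w x

namespace Summit.BirchSwinnertonDyer.BirchSwinnertonDyer.Theorems.SmallImageCharSignedSelmer

open Literature.NumberTheory.EllipticCurves

section FourTerm

variable (p : ℕ) [Fact p.Prime] {H : Type u} {Q : Type v} {X : Type w} {Y : Type x}
  [AddCommGroup H] [Module (IwasawaAlgebra p) H] [AddCommGroup Q] [Module (IwasawaAlgebra p) Q]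
  [AddCommGroup X] [Module (IwasawaAlgebra p) X] [AddCommGroup Y] [Module (IwasawaAlgebra p) Y]
  (f : H →ₗ[IwasawaAlgebra p] Q) (g : Q →ₗ[IwasawaAlgebra p] X) (h : X →ₗ[IwasawaAlgebra p] Y)

/-- **(A) `λ` through a four-term exact sequence.** If `H →ᶠ Q →ᵍ X →ʰ Y → 0` is exact and `X` is a finitely generated torsion `Λ`-module, then
`λ(X) = λ(Y) + λ(Q/f(H))` (`ker h = g(Q) ≅ Q/ker g = Q/f(H)` and additivity of `λ` along `h`). [cite: Washington1997, §13.2] [cite: Kobayashi2003, Thm. 7.3] -/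
theorem lambdaInvariant_eq_add_of_fourTerm [Module.Finite (IwasawaAlgebra p) X] (hX : Module.IsTorsion (IwasawaAlgebra p) X)
    (hfg : Function.Exact f g) (hgh : Function.Exact g h) (hh : Function.Surjective h) :
    lambdaInvariant p X = lambdaInvariant p Y + lambdaInvariant p (Q ⧸ LinearMap.range f) := by
  rw [Summit.BirchSwinnertonDyer.Rank1Residual.X2.DualRestrictionInvariants.lambdaInvariant_eq_add_of_surjective p h hX hh, add_comm]
  congr 1
  refine lambdaInvariant_eq_of_linearEquiv ?_
  -- `ker h = range g ≃ Q ⧸ ker g = Q ⧸ range f`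
  exact (LinearEquiv.ofEq _ _ hgh.linearMap_ker_eq).trans
    (g.quotKerEquivRange.symm.trans (Submodule.quotEquivOfEq _ _ hfg.linearMap_ker_eq))

/-- **(B) `λ(Q/f(Z)) = λ(H/Z) + λ(Q/f(H))`** for `f : H → Q` injective and `Z ≤ H`, when `Q/f(Z)` is a finitely generated torsion `Λ`-module: the surjection
`Q/f(Z) ↠ Q/f(H)` has kernel `f(H)/f(Z) ≅ H/Z`. [cite: Washington1997, §13.2] -/
theorem lambdaInvariant_quotient_map_eq_add (hf : Function.Injective f) (Z : Submodule (IwasawaAlgebra p) H)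
    [Module.Finite (IwasawaAlgebra p) (Q ⧸ Z.map f)] (hQ : Module.IsTorsion (IwasawaAlgebra p) (Q ⧸ Z.map f)) :
    lambdaInvariant p (Q ⧸ Z.map f) = lambdaInvariant p (H ⧸ Z) + lambdaInvariant p (Q ⧸ LinearMap.range f) := by
  have hle : Z.map f ≤ LinearMap.range f := LinearMap.map_le_range
  -- the image `W` of `H` in `Q ⧸ f(Z)` and the surjection onto `(Q ⧸ f(Z)) ⧸ W ≃ Q ⧸ f(H)`
  set W : Submodule (IwasawaAlgebra p) (Q ⧸ Z.map f) := LinearMap.range ((Z.map f).mkQ ∘ₗ f) with hW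
  rw [Summit.BirchSwinnertonDyer.Rank1Residual.X2.DualRestrictionInvariants.lambdaInvariant_eq_add_of_surjective p W.mkQ hQ (Submodule.mkQ_surjective W)]
  congr 1
  · -- `ker W.mkQ = W = range (mkQ ∘ f) ≃ H ⧸ ker (mkQ ∘ f) = H ⧸ Z`
    refine lambdaInvariant_eq_of_linearEquiv ?_
    have hker : LinearMap.ker ((Z.map f).mkQ ∘ₗ f) = Z := by
      rw [LinearMap.ker_comp, Submodule.ker_mkQ, Submodule.comap_map_eq_of_injective hf]
    exact (LinearEquiv.ofEq _ _ (Submodule.ker_mkQ W)).trans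
      (((Z.map f).mkQ ∘ₗ f).quotKerEquivRange.symm.trans (Submodule.quotEquivOfEq _ _ hker))
  · refine lambdaInvariant_eq_of_linearEquiv ?_
    have hWeq : W = (LinearMap.range f).map (Z.map f).mkQ := by rw [hW, LinearMap.range_comp]
    exact (Submodule.quotEquivOfEq _ _ hWeq).trans (Submodule.quotientQuotientEquivQuotient (Z.map f) (LinearMap.range f) hle)

/-- **(C) the shape of E2's inequality.** `H →ᶠ Q →ᵍ X →ʰ Y → 0` exact with `f` injective, `X` and `Q/f(Z)` finitely generated torsion (`Z ≤ H`), and the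
global input `λ(H/Z) ≤ λ(Y)`: then `λ(Q/f(Z)) ≤ λ(X)`. In E2: `H = 𝐇¹_Σ`, `Q = 𝐇¹_v/E^ε`, `Y = 𝐇²_Σ`, `Z` the zeta line, `Q/f(Z) ≅ Λ_𝒪/(Col^ε loc z_Σ)`.
[cite: Kobayashi2003, Thm. 7.3, Thm. 1.3] [cite: Washington1997, §13.2] -/
theorem lambdaInvariant_quotient_map_le_of_fourTerm [Module.Finite (IwasawaAlgebra p) X] (hX : Module.IsTorsion (IwasawaAlgebra p) X)
    (hfg : Function.Exact f g) (hgh : Function.Exact g h) (hh : Function.Surjective h) (hf : Function.Injective f)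
    (Z : Submodule (IwasawaAlgebra p) H) [Module.Finite (IwasawaAlgebra p) (Q ⧸ Z.map f)] (hQ : Module.IsTorsion (IwasawaAlgebra p) (Q ⧸ Z.map f))
    (hK : lambdaInvariant p (H ⧸ Z) ≤ lambdaInvariant p Y) :
    lambdaInvariant p (Q ⧸ Z.map f) ≤ lambdaInvariant p X := by
  rw [lambdaInvariant_eq_add_of_fourTerm p f g h hX hfg hgh hh, lambdaInvariant_quotient_map_eq_add p f hf Z hQ]
  exact Nat.add_le_add_right hK _

end FourTerm

end Summit.BirchSwinnertonDyer.BirchSwinnertonDyer.Theorems.SmallImageCharSignedSelmer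

end
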